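import Literature.NumberTheory.EllipticCurves.ToricTwoVariablePAdicLFunction
import Literature.NumberTheory.EllipticCurves.BDPAnticyclotomicPAdicLFunctionUpTo
import HarnessLib

/-!
# The two-variable toric interpolation property UP TO A NONZERO CONSTANT (`IsToricTwoVarLFunctionUpTo`)

A one-parameter relaxation of the characterising predicate `IsToricTwoVarLFunction`
(`ToricTwoVariablePAdicLFunction.lean`, Castella–Wan Thm. 2.11's display in the CM-period
normalisation): `IsToricTwoVarLFunctionUpTo C ι 𝔭 𝔭' κ₁ κ₂ γ₁ γ₂ f Ω_K Ω_p L₂` asks that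
`L₂ ∈ R₀⟦T₁⟧⟦T₂⟧` take at `(T₁, T₂) = (r(γ₁) − 1, r(γ₂) − 1)` the value
`C · ι⁻¹(display value) · Ω_p^{2(a+b)}` for every everywhere-unramified Hecke character `ψ` of
infinity type `(−a, b)` in the critical cone `Σ⁺` — the SAME interpolation range and the SAME `ψ`-,
`a`-, `b`-dependence as `IsToricTwoVarLFunction`, with one `ψ`-, `a`-, `b`-independent constant
`C ∈ ℂ_p` in front. `C = 1` is `IsToricTwoVarLFunction` (`isToricTwoVarLFunctionUpTo_one_iff`). This
is, word for word, to `IsToricTwoVarLFunction` what the tree's `IsBDPLFunctionUpTo`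
(`BDPAnticyclotomicPAdicLFunctionUpTo.lean`) is to `IsBDPLFunction`.

WHY (statement hygiene for RATIONAL consumers). The printed constructions of two-variable
`𝛉`-dominant `p`-adic `L`-functions carry constants outside the display that are NOT `p`-adic units
in general: Hida's measure attached to a fixed form `g` (Ann. Inst. Fourier 38 (1988), §5, Thm. 5.1b)
is integral only after multiplication by the congruence number of the CM family (the denominator
`H` of the Rankin–Selberg method), and the renormalisation of Castella–Wan Thm. 2.11 («Moreover»,
congruence module = anticyclotomic Katz `L`-value) removes it only under their running hypotheses
(`p ∤ N`, `p ≥ 5`). A consumer that needs the two-variable function only UP TO A BOUNDED POWER OF `p`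
— e.g. a main-conjecture INCLUSION with `p`-power slack — should quantify over
`∃ C ≠ 0, ∃ L₂, IsToricTwoVarLFunctionUpTo C … L₂` (an `R₀`-integral series interpolating `C` times
the displayed values; `C = p^{-c}` records `c` powers of denominators), not over the exact display.
`(a+b)`-graded constants are absorbed by the free periods; what `C` does NOT absorb is a wrong SHAPE
of the `ψ`/`(a, b)`-dependence (not claimed).

Contents: `IsToricTwoVarLFunctionUpTo` (def, a characterising PREDICATE with parameters — not a
construction, not an existence claim, nothing asserted), `isToricTwoVarLFunctionUpTo_one_iff`,
`IsToricTwoVarLFunction.upTo_one`, `IsToricTwoVarLFunctionUpTo.hasValueAt₂`,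
`IsToricTwoVarLFunctionUpTo.eq_of_hasValueAt₂`, `IsToricTwoVarLFunctionUpTo.hasValueAt₂_centralRay`
(agreement with `IsBDPLFunctionUpTo C` on the central ray, value by value). No instance, no
notation, no named fact (net debt delta `0`).

References: [CastellaWan2023] F. Castella, X. Wan, §2.4 Thm. 2.11, Cor. 2.12 (arXiv:1607.02019).
[Castella2018] F. Castella, Camb. J. Math. 6 (2018), Thm. 3.1. [Hida1988AIF] H. Hida, Ann. Inst.
Fourier 38 (1988) no. 3, §5 Thm. 5.1b (doi:10.5802/aif.1141). [CastellaHsieh2018] Math. Ann. 370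
(2018), §3.3 (infinity types and avatars).
-/

noncomputable section

open scoped MatrixGroups ModularForm Topology
open CongruenceSubgroup NumberField IsDedekindDomain Field
open Literature.NumberTheory.GaloisRepresentations
open Literature.NumberTheory.EllipticCurves.ModularForms

namespace Literature.NumberTheory.EllipticCurves

universe u

section FrameUpTo

variable {K : Type u} [Field K] [NumberField K] {N : ℕ} {p : ℕ} [Fact p.Prime]

/-- **The toric two-variable interpolation property UP TO A CONSTANT `C ∈ ℂ_p`** (Castella–Wan
Thm. 2.11's display with one `ψ`-, `a`-, `b`-independent constant in front): for every idelic Hecke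
character `ψ` of `K` unramified at every finite place, of infinity type `(−a, b)` with `a, b ≥ 1`
(tree `HasInfinityType (fun _ ↦ a) (fun _ ↦ −b)`), every `p`-adic avatar `r` of `ψ` factoring
through the pair `(κ₁, κ₂)`, and every ENTIRE `L` agreeing with the Euler product `L(f/K, ψ, s)` on
`re s > a + 2`, the value of `L₂` at `(T₁, T₂) = (r(γ₁) − 1, r(γ₂) − 1)` is
`C · ι⁻¹( Γ(b)Γ(b+1)/π^{2b+1} · 𝓔(f, ψ) · L(1) / Ω_K^{2(a+b)} ) · Ω_p^{2(a+b)}` — word for word the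
body of `IsToricTwoVarLFunction` with the value multiplied by `C`. `C = 1` is `IsToricTwoVarLFunction`
(`isToricTwoVarLFunctionUpTo_one_iff`). A characterising PREDICATE; nothing asserted.
[cite: CastellaWan2023, §2.4 Thm. 2.11 with §2.1 (Σ⁺, Def. 2.1) and Thm. 2.7 (arXiv:1607.02019)]
[cite: Hida1988AIF, §5 Thm. 5.1b (the congruence denominator)] [cite: Castella2018, Thm. 3.1] -/
def IsToricTwoVarLFunctionUpTo (C : ℂ_[p]) (ι : PadicAlgCl p ≃+* ℂ) (𝔭 𝔭' : HeightOneSpectrum (𝓞 K))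
    (κ₁ κ₂ : ZpExtension K p) (γ₁ γ₂ : absoluteGaloisGroup K) (f : CuspForm (Gamma0 N) 2) (ΩK : ℂ)
    (Ωp : ℂ_[p]) (L₂ : PowerSeries (UnrSeries p)) : Prop :=
  ∀ (ψ : HeckeCharacter K) (a b : ℕ), 1 ≤ a → 1 ≤ b →
    ψ.HasInfinityType (fun _ ↦ (a : ℤ)) (fun _ ↦ -(b : ℤ)) →
    (∀ w : HeightOneSpectrum (𝓞 K), ψ.IsUnramifiedAt w) →
    ∀ r : FramedGaloisRep K (PadicAlgCl p) 1, IsPAdicAvatarOf ι ψ r → FactorsThroughPair κ₁ κ₂ r →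
    ∀ L : ℂ → ℂ, Differentiable ℂ L →
      (∀ s : ℂ, (a : ℝ) + 2 < s.re → L s = rankinSelbergEulerProductHecke f ψ s) →
      UnrSeries.HasValueAt₂ L₂ (avatarValueAt r γ₁ - 1) (avatarValueAt r γ₂ - 1)
        (C * ((((ι.symm (toricInterpolationValue p f 𝔭 𝔭' ψ a b ΩK (L 1))) : PadicAlgCl p) : ℂ_[p]) *
          Ωp ^ (2 * (a + b))))

variable {ι : PadicAlgCl p ≃+* ℂ} {𝔭 𝔭' : HeightOneSpectrum (𝓞 K)} {κ₁ κ₂ : ZpExtension K p}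
  {γ₁ γ₂ : absoluteGaloisGroup K} {f : CuspForm (Gamma0 N) 2} {ΩK : ℂ} {Ωp : ℂ_[p]}
  {L₂ : PowerSeries (UnrSeries p)} {C : ℂ_[p]}

/-- **`C = 1` is Castella–Wan's exact display**: `IsToricTwoVarLFunctionUpTo 1 … ↔ IsToricTwoVarLFunction …`.
[cite: CastellaWan2023, §2.4 Thm. 2.11 (arXiv:1607.02019)] -/
theorem isToricTwoVarLFunctionUpTo_one_iff :
    IsToricTwoVarLFunctionUpTo 1 ι 𝔭 𝔭' κ₁ κ₂ γ₁ γ₂ f ΩK Ωp L₂ ↔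
      IsToricTwoVarLFunction ι 𝔭 𝔭' κ₁ κ₂ γ₁ γ₂ f ΩK Ωp L₂ := by
  simp only [IsToricTwoVarLFunctionUpTo, IsToricTwoVarLFunction, one_mul]

/-- An exact toric frame is a toric frame up to the constant `1`.
[cite: CastellaWan2023, §2.4 Thm. 2.11 (arXiv:1607.02019)] -/
theorem IsToricTwoVarLFunction.upTo_one (h : IsToricTwoVarLFunction ι 𝔭 𝔭' κ₁ κ₂ γ₁ γ₂ f ΩK Ωp L₂) :
    IsToricTwoVarLFunctionUpTo 1 ι 𝔭 𝔭' κ₁ κ₂ γ₁ γ₂ f ΩK Ωp L₂ :=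
  isToricTwoVarLFunctionUpTo_one_iff.mpr h

/-- Unfolding `IsToricTwoVarLFunctionUpTo` at one character of the typed range: the prescribed value
of `L₂` at `(r(γ₁) − 1, r(γ₂) − 1)`. [cite: CastellaWan2023, §2.4 Thm. 2.11 (arXiv:1607.02019)] -/
theorem IsToricTwoVarLFunctionUpTo.hasValueAt₂
    (hL : IsToricTwoVarLFunctionUpTo C ι 𝔭 𝔭' κ₁ κ₂ γ₁ γ₂ f ΩK Ωp L₂)
    {ψ : HeckeCharacter K} {a b : ℕ} (ha : 1 ≤ a) (hb : 1 ≤ b)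
    (hinf : ψ.HasInfinityType (fun _ ↦ (a : ℤ)) (fun _ ↦ -(b : ℤ)))
    (hunr : ∀ w : HeightOneSpectrum (𝓞 K), ψ.IsUnramifiedAt w)
    {r : FramedGaloisRep K (PadicAlgCl p) 1} (hr : IsPAdicAvatarOf ι ψ r)
    (hκ : FactorsThroughPair κ₁ κ₂ r) {L : ℂ → ℂ} (hLd : Differentiable ℂ L)
    (hLe : ∀ s : ℂ, (a : ℝ) + 2 < s.re → L s = rankinSelbergEulerProductHecke f ψ s) :
    UnrSeries.HasValueAt₂ L₂ (avatarValueAt r γ₁ - 1) (avatarValueAt r γ₂ - 1)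
      (C * ((((ι.symm (toricInterpolationValue p f 𝔭 𝔭' ψ a b ΩK (L 1))) : PadicAlgCl p) : ℂ_[p]) *
        Ωp ^ (2 * (a + b)))) :=
  hL ψ a b ha hb hinf hunr r hr hκ L hLd hLe

/-- The prescribed value at a character in the range of interpolation is unique: any `v` with
`HasValueAt₂ L₂ (r(γ₁) − 1) (r(γ₂) − 1) v` is `C` times Castella–Wan's right-hand side (a `HasSum`
limit in the Hausdorff space `ℂ_p`). [cite: CastellaWan2023, §2.4 Thm. 2.11 (arXiv:1607.02019)] -/
theorem IsToricTwoVarLFunctionUpTo.eq_of_hasValueAt₂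
    (hL : IsToricTwoVarLFunctionUpTo C ι 𝔭 𝔭' κ₁ κ₂ γ₁ γ₂ f ΩK Ωp L₂)
    {ψ : HeckeCharacter K} {a b : ℕ} (ha : 1 ≤ a) (hb : 1 ≤ b)
    (hinf : ψ.HasInfinityType (fun _ ↦ (a : ℤ)) (fun _ ↦ -(b : ℤ)))
    (hunr : ∀ w : HeightOneSpectrum (𝓞 K), ψ.IsUnramifiedAt w)
    {r : FramedGaloisRep K (PadicAlgCl p) 1} (hr : IsPAdicAvatarOf ι ψ r)
    (hκ : FactorsThroughPair κ₁ κ₂ r) {L : ℂ → ℂ} (hLd : Differentiable ℂ L)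
    (hLe : ∀ s : ℂ, (a : ℝ) + 2 < s.re → L s = rankinSelbergEulerProductHecke f ψ s) {v : ℂ_[p]}
    (hv : UnrSeries.HasValueAt₂ L₂ (avatarValueAt r γ₁ - 1) (avatarValueAt r γ₂ - 1) v) :
    v = C * ((((ι.symm (toricInterpolationValue p f 𝔭 𝔭' ψ a b ΩK (L 1))) : PadicAlgCl p) : ℂ_[p]) *
      Ωp ^ (2 * (a + b))) :=
  hv.unique (hL.hasValueAt₂ ha hb hinf hunr hr hκ hLd hLe)

/-- **Agreement with the one-variable ♯-frame on the central ray.** For an everywhere unramified `ψ`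
of type `(−n, n)`, `n > 0` (tree `(n, −n)`) with `ψ(𝔭̄) = ψ(𝔭)⁻¹`, avatar `r` through the pair, and
an entire continuation `L` of `L(f/K, ψ, s)` from `re s > 3/2`, the value the ♯-predicate prescribes
at `(r(γ₁) − 1, r(γ₂) − 1)` is EXACTLY the right-hand side of `IsBDPLFunctionUpTo C` at `(ψ, n)`:
`C · ι⁻¹(bdpInterpolationValue p f 𝔭 ψ n ΩK) · Ωp^{4n}` (as `IsToricTwoVarLFunction.hasValueAt₂_centralRay`,
times `C`). [cite: CastellaWan2023, Cor. 2.12 with Thm. 2.7 and Thm. 2.11 (arXiv:1607.02019)] [cite: Castella2018, Thm. 3.1] -/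
theorem IsToricTwoVarLFunctionUpTo.hasValueAt₂_centralRay
    (hL : IsToricTwoVarLFunctionUpTo C ι 𝔭 𝔭' κ₁ κ₂ γ₁ γ₂ f ΩK Ωp L₂)
    {ψ : HeckeCharacter K} {n : ℕ} (hn : 0 < n)
    (hinf : ψ.HasInfinityType (fun _ ↦ (n : ℤ)) (fun _ ↦ -(n : ℤ)))
    (hunr : ∀ w : HeightOneSpectrum (𝓞 K), ψ.IsUnramifiedAt w)
    (hψ : heckeValueExtZero ψ 𝔭' = (heckeValueExtZero ψ 𝔭)⁻¹)
    {r : FramedGaloisRep K (PadicAlgCl p) 1} (hr : IsPAdicAvatarOf ι ψ r)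
    (hκ : FactorsThroughPair κ₁ κ₂ r) {L : ℂ → ℂ} (hLd : Differentiable ℂ L)
    (hLe : ∀ s : ℂ, 3 / 2 < s.re → L s = rankinSelbergEulerProductHecke f ψ s) :
    UnrSeries.HasValueAt₂ L₂ (avatarValueAt r γ₁ - 1) (avatarValueAt r γ₂ - 1)
      (C * ((((ι.symm (bdpInterpolationValue p f 𝔭 ψ n ΩK)) : PadicAlgCl p) : ℂ_[p]) * Ωp ^ (4 * n))) := by
  have hLe' : ∀ s : ℂ, (n : ℝ) + 2 < s.re → L s = rankinSelbergEulerProductHecke f ψ s :=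
    fun s hs ↦ hLe s (by have : (0 : ℝ) ≤ n := Nat.cast_nonneg n; linarith)
  have h := hL.hasValueAt₂ hn hn hinf hunr hr hκ hLd hLe'
  rw [← rankinSelbergValueHecke_eq hLd hLe 1,
    toricInterpolationValue_diag_eq_bdpInterpolationValue p f hψ n ΩK] at h
  convert h using 3
  ring

end FrameUpTo

/-! ### §2. The interpolation property UP TO A CONSTANT AND TWO INDEPENDENT GRADINGS (`IsToricTwoVarLFunctionUpTo₂`)
— statement hygiene at an ADDITIVE prime of `f` (appended 2026-08-29, LEAD `cruxlead-24207` g3)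

WHY. `IsToricTwoVarLFunctionUpTo C` leaves ONE constant and the single grading `Ω_p^{2(a+b)}` free. At a prime `p`
with `p^c ∥ N`, `c ≥ 1`, the interpolation formula of the `𝛉`-dominant two-variable `p`-adic `L`-function carries —
besides the Euler polynomial read off the level (`bdpLocalFactor`, here `ε_p = 0`) — the local `ε`-FACTOR of
`π_{f,p}` twisted by the varying unramified unit-root character: in Hao–Loeffler's interpolation formula (ordinary
family = the CM family through `θ_ψ`, universal-deformation family through `g = f`, any prime `p > 2`, any
`p`-level `p^b` of `g`) this is the factor `λ_p(g)^b · (p^{t+1}/α)^b` («essentially the local `ε`-factor»), which in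
the toric dictionary (`t + 1 = b`, `α = ψ₁(𝔭̄)` the unit root of `θ_{ψ₁}`, `ψ = ψ₁ N^{−b}` of type `(a, −b)`) reads
`λ_p(f)^c · ψ(𝔭̄)^{−c}`: a constant, times the value of a group-like element of `Λ₂` (a unit), times `p^{c·b}`. The
size `p^{c·b}` is graded by `b` ALONE; it is absorbed neither by `C` nor by `Ω_p^{2(a+b)}`, and no non-zero element of
`Frac Λ₂ ⊗ ℂ_p` takes the values `p^{cb} · X^{a+b}` on the (Zariski-dense) interpolation set. Consequently a consumer at
an additive `p` that pins `L₂` by `IsToricTwoVarLFunctionUpTo C` asks for an object that cannot exist once `c ≥ 1` and one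
`L`-value of the family is non-zero. The predicate below frees a SECOND grading: values `C · X^a · Y^b · ι⁻¹(display)`,
`C, X, Y ∈ ℂ_p` (`X = Y = Ω_p²` recovers the ♯-form: `IsToricTwoVarLFunctionUpTo.upTo₂`); the remaining discrepancy
with any printed normalisation at an additive `p` is a UNIT of `Λ₂`, to which ideal-theoretic consumers
(characteristic-ideal inclusions, divisibilities with `p`-power slack, `Associated`) are insensitive. On the central ray
`a = b = n` the prescribed value is `C · ι⁻¹(bdpInterpolationValue …) · Ω_p^{4n}` for ANY fourth root `Ω_p` of `X·Y`
(`IsToricTwoVarLFunctionUpTo₂.hasValueAt₂_centralRay`), so one-variable consumers see an ordinary ♯-frame. What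
`C, X, Y` do NOT absorb: a wrong `ψ`-dependence beyond gradings (not claimed). A characterising PREDICATE; nothing
asserted; no instance, no notation, no named fact.
[cite: HaoLoeffler2025, Thm. 3.5 and §1.2 (arXiv:2405.12611)] [cite: CastellaWan2023, §2.4 Thm. 2.11 (arXiv:1607.02019)]
[cite: Loeffler2023UniversalDeformation, Thm. 4.5 (arXiv:2003.13738)] -/

section FrameUpTo₂

variable {K : Type u} [Field K] [NumberField K] {N : ℕ} {p : ℕ} [Fact p.Prime]

/-- **The toric two-variable interpolation property UP TO A CONSTANT `C` AND TWO INDEPENDENT GRADINGS `X^a · Y^b`**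
(`C, X, Y ∈ ℂ_p`): for every everywhere-unramified Hecke character `ψ` of `K` of infinity type `(−a, b)`, `a, b ≥ 1`
(tree type `(a, −b)`), every `p`-adic avatar `r` of `ψ` factoring through the pair `(κ₁, κ₂)` and every ENTIRE `L`
agreeing with the Euler product `L(f/K, ψ, s)` on `re s > a + 2`, the value of `L₂` at `(r(γ₁) − 1, r(γ₂) − 1)` is
`C · X^a · Y^b · ι⁻¹( Γ(b)Γ(b+1)/π^{2b+1} · 𝓔(f, ψ) · L(1) / Ω_K^{2(a+b)} )` — the body of `IsToricTwoVarLFunctionUpTo`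
with `Ω_p^{2(a+b)}` replaced by `X^a · Y^b` (the ♯-form is `X = Y = Ω_p²`). The second grading absorbs the `p`-adic size
`p^{c·b}` of the local `ε`-factor of `π_{f,p}` at a prime `p^c ∥ N` (Hao–Loeffler Thm. 3.5: the factor
`λ_p(g)^b (p^{t+1}/α)^b`). A characterising PREDICATE; nothing asserted.
[cite: HaoLoeffler2025, Thm. 3.5 (arXiv:2405.12611)] [cite: CastellaWan2023, §2.4 Thm. 2.11 (arXiv:1607.02019)] -/
def IsToricTwoVarLFunctionUpTo₂ (C X Y : ℂ_[p]) (ι : PadicAlgCl p ≃+* ℂ) (𝔭 𝔭' : HeightOneSpectrum (𝓞 K))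
    (κ₁ κ₂ : ZpExtension K p) (γ₁ γ₂ : absoluteGaloisGroup K) (f : CuspForm (Gamma0 N) 2) (ΩK : ℂ)
    (L₂ : PowerSeries (UnrSeries p)) : Prop :=
  ∀ (ψ : HeckeCharacter K) (a b : ℕ), 1 ≤ a → 1 ≤ b →
    ψ.HasInfinityType (fun _ ↦ (a : ℤ)) (fun _ ↦ -(b : ℤ)) →
    (∀ w : HeightOneSpectrum (𝓞 K), ψ.IsUnramifiedAt w) →
    ∀ r : FramedGaloisRep K (PadicAlgCl p) 1, IsPAdicAvatarOf ι ψ r → FactorsThroughPair κ₁ κ₂ r →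
    ∀ L : ℂ → ℂ, Differentiable ℂ L →
      (∀ s : ℂ, (a : ℝ) + 2 < s.re → L s = rankinSelbergEulerProductHecke f ψ s) →
      UnrSeries.HasValueAt₂ L₂ (avatarValueAt r γ₁ - 1) (avatarValueAt r γ₂ - 1)
        (C * X ^ a * Y ^ b *
          ((((ι.symm (toricInterpolationValue p f 𝔭 𝔭' ψ a b ΩK (L 1))) : PadicAlgCl p) : ℂ_[p])))

variable {ι : PadicAlgCl p ≃+* ℂ} {𝔭 𝔭' : HeightOneSpectrum (𝓞 K)} {κ₁ κ₂ : ZpExtension K p}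
  {γ₁ γ₂ : absoluteGaloisGroup K} {f : CuspForm (Gamma0 N) 2} {ΩK : ℂ} {Ωp : ℂ_[p]}
  {L₂ : PowerSeries (UnrSeries p)} {C X Y : ℂ_[p]}

/-- Unfolding `IsToricTwoVarLFunctionUpTo₂` at one character of the typed range: the prescribed value of `L₂` at
`(r(γ₁) − 1, r(γ₂) − 1)`. [cite: HaoLoeffler2025, Thm. 3.5 (arXiv:2405.12611)] [cite: CastellaWan2023, §2.4 Thm. 2.11 (arXiv:1607.02019)] -/
theorem IsToricTwoVarLFunctionUpTo₂.hasValueAt₂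
    (hL : IsToricTwoVarLFunctionUpTo₂ C X Y ι 𝔭 𝔭' κ₁ κ₂ γ₁ γ₂ f ΩK L₂)
    {ψ : HeckeCharacter K} {a b : ℕ} (ha : 1 ≤ a) (hb : 1 ≤ b)
    (hinf : ψ.HasInfinityType (fun _ ↦ (a : ℤ)) (fun _ ↦ -(b : ℤ)))
    (hunr : ∀ w : HeightOneSpectrum (𝓞 K), ψ.IsUnramifiedAt w)
    {r : FramedGaloisRep K (PadicAlgCl p) 1} (hr : IsPAdicAvatarOf ι ψ r)
    (hκ : FactorsThroughPair κ₁ κ₂ r) {L : ℂ → ℂ} (hLd : Differentiable ℂ L)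
    (hLe : ∀ s : ℂ, (a : ℝ) + 2 < s.re → L s = rankinSelbergEulerProductHecke f ψ s) :
    UnrSeries.HasValueAt₂ L₂ (avatarValueAt r γ₁ - 1) (avatarValueAt r γ₂ - 1)
      (C * X ^ a * Y ^ b *
        ((((ι.symm (toricInterpolationValue p f 𝔭 𝔭' ψ a b ΩK (L 1))) : PadicAlgCl p) : ℂ_[p]))) :=
  hL ψ a b ha hb hinf hunr r hr hκ L hLd hLe

/-- The prescribed value at a character in the range of interpolation is unique (a `HasSum` limit in the Hausdorff
space `ℂ_p`). [cite: CastellaWan2023, §2.4 Thm. 2.11 (arXiv:1607.02019)] -/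
theorem IsToricTwoVarLFunctionUpTo₂.eq_of_hasValueAt₂
    (hL : IsToricTwoVarLFunctionUpTo₂ C X Y ι 𝔭 𝔭' κ₁ κ₂ γ₁ γ₂ f ΩK L₂)
    {ψ : HeckeCharacter K} {a b : ℕ} (ha : 1 ≤ a) (hb : 1 ≤ b)
    (hinf : ψ.HasInfinityType (fun _ ↦ (a : ℤ)) (fun _ ↦ -(b : ℤ)))
    (hunr : ∀ w : HeightOneSpectrum (𝓞 K), ψ.IsUnramifiedAt w)
    {r : FramedGaloisRep K (PadicAlgCl p) 1} (hr : IsPAdicAvatarOf ι ψ r)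
    (hκ : FactorsThroughPair κ₁ κ₂ r) {L : ℂ → ℂ} (hLd : Differentiable ℂ L)
    (hLe : ∀ s : ℂ, (a : ℝ) + 2 < s.re → L s = rankinSelbergEulerProductHecke f ψ s) {v : ℂ_[p]}
    (hv : UnrSeries.HasValueAt₂ L₂ (avatarValueAt r γ₁ - 1) (avatarValueAt r γ₂ - 1) v) :
    v = C * X ^ a * Y ^ b *
      ((((ι.symm (toricInterpolationValue p f 𝔭 𝔭' ψ a b ΩK (L 1))) : PadicAlgCl p) : ℂ_[p])) :=
  hv.unique (hL.hasValueAt₂ ha hb hinf hunr hr hκ hLd hLe)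

/-- **A ♯-frame is a ♯♯-frame with `X = Y = Ω_p²`**: `IsToricTwoVarLFunctionUpTo C … Ω_p L₂ →
IsToricTwoVarLFunctionUpTo₂ C (Ω_p²) (Ω_p²) … L₂` (`Ω_p^{2(a+b)} = (Ω_p²)^a (Ω_p²)^b`).
[cite: CastellaWan2023, §2.4 Thm. 2.11 (arXiv:1607.02019)] -/
theorem IsToricTwoVarLFunctionUpTo.upTo₂ (h : IsToricTwoVarLFunctionUpTo C ι 𝔭 𝔭' κ₁ κ₂ γ₁ γ₂ f ΩK Ωp L₂) :
    IsToricTwoVarLFunctionUpTo₂ C (Ωp ^ 2) (Ωp ^ 2) ι 𝔭 𝔭' κ₁ κ₂ γ₁ γ₂ f ΩK L₂ := by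
  intro ψ a b ha hb hinf hunr r hr hκ L hLd hLe
  have hv := h ψ a b ha hb hinf hunr r hr hκ L hLd hLe
  have e : C * ((((ι.symm (toricInterpolationValue p f 𝔭 𝔭' ψ a b ΩK (L 1))) : PadicAlgCl p) : ℂ_[p]) *
        Ωp ^ (2 * (a + b))) =
      C * (Ωp ^ 2) ^ a * (Ωp ^ 2) ^ b *
        ((((ι.symm (toricInterpolationValue p f 𝔭 𝔭' ψ a b ΩK (L 1))) : PadicAlgCl p) : ℂ_[p])) := by
    ring
  rwa [e] at hv

/-- An exact toric frame is a ♯♯-frame with `C = 1`, `X = Y = Ω_p²`. [cite: CastellaWan2023, §2.4 Thm. 2.11 (arXiv:1607.02019)] -/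
theorem IsToricTwoVarLFunction.upTo₂ (h : IsToricTwoVarLFunction ι 𝔭 𝔭' κ₁ κ₂ γ₁ γ₂ f ΩK Ωp L₂) :
    IsToricTwoVarLFunctionUpTo₂ 1 (Ωp ^ 2) (Ωp ^ 2) ι 𝔭 𝔭' κ₁ κ₂ γ₁ γ₂ f ΩK L₂ :=
  h.upTo_one.upTo₂

/-- **Agreement with the one-variable ♯-frame on the central ray, for any fourth root `Ω_p` of `X·Y`.** For an
everywhere unramified `ψ` of type `(−n, n)`, `n > 0`, with `ψ(𝔭̄) = ψ(𝔭)⁻¹`, avatar `r` through the pair, and an entire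
continuation `L` of `L(f/K, ψ, s)` from `re s > 3/2`, the value the ♯♯-predicate prescribes at `(r(γ₁) − 1, r(γ₂) − 1)` is
`C · ι⁻¹(bdpInterpolationValue p f 𝔭 ψ n Ω_K) · Ω_p^{4n}` whenever `Ω_p⁴ = X·Y` (`X^n Y^n = (Ω_p⁴)^n`): on the central ray a
♯♯-frame is an ordinary ♯-frame of the one-variable predicate `IsBDPLFunctionUpTo C`.
[cite: CastellaWan2023, Cor. 2.12 with Thm. 2.7 and Thm. 2.11 (arXiv:1607.02019)] [cite: Castella2018, Thm. 3.1] -/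
theorem IsToricTwoVarLFunctionUpTo₂.hasValueAt₂_centralRay
    (hL : IsToricTwoVarLFunctionUpTo₂ C X Y ι 𝔭 𝔭' κ₁ κ₂ γ₁ γ₂ f ΩK L₂) (hΩp : Ωp ^ 4 = X * Y)
    {ψ : HeckeCharacter K} {n : ℕ} (hn : 0 < n)
    (hinf : ψ.HasInfinityType (fun _ ↦ (n : ℤ)) (fun _ ↦ -(n : ℤ)))
    (hunr : ∀ w : HeightOneSpectrum (𝓞 K), ψ.IsUnramifiedAt w)
    (hψ : heckeValueExtZero ψ 𝔭' = (heckeValueExtZero ψ 𝔭)⁻¹)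
    {r : FramedGaloisRep K (PadicAlgCl p) 1} (hr : IsPAdicAvatarOf ι ψ r)
    (hκ : FactorsThroughPair κ₁ κ₂ r) {L : ℂ → ℂ} (hLd : Differentiable ℂ L)
    (hLe : ∀ s : ℂ, 3 / 2 < s.re → L s = rankinSelbergEulerProductHecke f ψ s) :
    UnrSeries.HasValueAt₂ L₂ (avatarValueAt r γ₁ - 1) (avatarValueAt r γ₂ - 1)
      (C * ((((ι.symm (bdpInterpolationValue p f 𝔭 ψ n ΩK)) : PadicAlgCl p) : ℂ_[p]) * Ωp ^ (4 * n))) := by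
  have hLe' : ∀ s : ℂ, (n : ℝ) + 2 < s.re → L s = rankinSelbergEulerProductHecke f ψ s :=
    fun s hs ↦ hLe s (by have : (0 : ℝ) ≤ n := Nat.cast_nonneg n; linarith)
  have h := hL.hasValueAt₂ hn hn hinf hunr hr hκ hLd hLe'
  rw [← rankinSelbergValueHecke_eq hLd hLe 1,
    toricInterpolationValue_diag_eq_bdpInterpolationValue p f hψ n ΩK] at h
  have e : C * X ^ n * Y ^ n * ((((ι.symm (bdpInterpolationValue p f 𝔭 ψ n ΩK)) : PadicAlgCl p) : ℂ_[p])) =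
      C * ((((ι.symm (bdpInterpolationValue p f 𝔭 ψ n ΩK)) : PadicAlgCl p) : ℂ_[p]) * Ωp ^ (4 * n)) := by
    rw [pow_mul, hΩp, mul_pow]; ring
  rwa [e] at h

end FrameUpTo₂

end Literature.NumberTheory.EllipticCurves

end
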